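import Mathlib

/-!
# `Balaban1983to89.B7` — T. Balaban, *Averaging operations for lattice gauge theories*,
Commun. Math. Phys. **98**, 17–51 (1985).  (INDEX: B7; refs: [1] = B4 area, [2] = B5.)
PDF held: `paper:balaban1985-cmp98-averaging` (journal page = PDF page + 16).

CITATION HEADER (lean-in-tree rule 2026-08-18). This module is a TYPED SKELETON (statement level) of the published paper
T. Bałaban, "Averaging operations for lattice gauge theories", *Comm. Math. Phys.* **98**, 17–51 (1985) [Balaban1985Averaging] (cell paper B7).
WHAT IS REPRODUCED: the main theorems/propositions as `def … : Prop` carrying the VERBATIM printed statement in the docstring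
(journal page + equation numbers), over abstract carrier structures whose Prop-valued fields name the printed hypotheses; plus a few
kernel-checked pieces of elementary arithmetic re-deriving printed constants (the audit's "second engine").  NOTHING of the series is
asserted: the series' end-statement (ultraviolet stability of 4-d lattice gauge theories, [Balaban1987RG1] Thm 2 ff.) is a CLAIM UNDER
ADJUDICATION by the audit cell `pub-balaban`; every `…Printed` Prop here is consumed downstream only as a hypothesis `(h : …Printed …)`.
The cell's line-by-line census of this paper (objections located to page/equation, certifications) is the cell's GAPS.md (ids quoted in
the docstrings: C-… certified, G-… objection/flag, D-… divergence row of the cell's DIVERGENCE.md).  Why local carrier structures and not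
the shared `Setup` vocabulary (`…Balaban1983to89.Setup`): this paper's statements quantify over operator KERNELS and norm functionals
(random-walk expansions, Hölder norms, weighted sup norms, quadratic forms) that `Setup` deliberately does not model; the carriers only
NAME those functionals as fields, so no `Setup` definition is restated here and nothing is defined twice.  Staged byte-identically in the
cell package `run/shared/lean/pub/pub-balaban/lean/BalabanYm4/Literature/MathematicalPhysics/QuantumFieldTheory/Balaban1983to89/B7.lean`
(legacy copy `BalabanYm4/B7.lean` there, namespace `BalabanYm4.B7`, same declarations).

Unit `b2b-balaban-r1` (reader group A).  STATEMENT LEVEL ONLY: Propositions 1–10 (pp. 26–50) typed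
over an abstract carrier; every docstring quotes the printed statement VERBATIM with its journal page;
hypotheses are explicit predicate arguments; the quantifier order of the constants ("C₀ depends on d only,
c'₂ on d and L", …) is made explicit by choosing the constants BEFORE the instance of the family.
Nothing analytic is proved.  KERNEL-CHECKED here: the elementary arithmetic this reader certified by hand
(census C-B7-2: Prop. 2 ⇐ Prop. 1 induction constants; G-B7-03: the sample constants of (155)) — a second,
independent engine for those constants.  Companion prose record: `HOME/b2b-balaban-r1/B7.md`;
gap census: `HOME/GAPS.md` rows C-B7-*, G-B7-*.

Unit `b2b-balaban-b07` (paper sub-cell, phase 2) revision.  (i) Proposition 9 (p. 49), previously folded into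
Prop. 10, is typed verbatim (`GaugeOneStep`, `Prop9Printed`; LEMMAS T04.9) and joined to `Concl` (`p9`).
(ii) KERNEL-CHECKED BOOKKEEPING — the paper-internal implications "proposition ⇐ its one-step lemma" exactly as the
printed proofs structure them, at the level of the numerical suprema (the identification of each abstract `step`
hypothesis with the one-step proposition applied to the level-j averages — rescalings (9)–(10), (127), (179) — is
carrier semantics, DIVERGENCE D-b07.4): (53) and Prop. 2 ⇐ Prop. 1 (`step53_alg`, `ineq53_induction`,
`prop2_of_ineq53`); (130), the closure of (131) and (133) `C₂ = e^{O(1)2α₀}8C₁` behind Prop. 4 ⇐ Prop. 3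
(`ineq130_induction`, `ineq131_closure`, `ineq133_of_130`); (145) (`ineq145_bracket`); (171)–(173) behind Prop. 8
(`ineq173_recursion`); (203)–(206), Prop. 10 ⇐ Prop. 9 (`step205_alg`, `prop10_induction`, `ineq204_closed`).
(iii) Docstring corrections: the Prop. 1 quotation made letter-exact; locators of Props. 8 and 10; G-B7-05 (Props. 6–7)
re-adjudicated in phase 2: Prop. 6 has a printed proof, (159)–(163), certified; Prop. 7 and the Prop. 5 extension are
certified as a proof-by-modification with an explicit five-item delta list (cell GAPS C-B7-E; cf. C-A7-1).  (iv) N-B7-1 (the constant 24 of (38)) is certified NUMERICALLY by three independent engines (true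
constant ≤ 1.382; cell file `b2b-balaban-b07/num/bch38.py`) and, since cell gen 8, KERNEL-CHECKED in the companion
module `B7Eq38Remainder` (`eq38_printed`: for `|X| ≤ 1/20`, `|Y| ≤ 1/12`, `(1/i) log e^{iX}e^{iY} = Y + D36 X Y + 𝓕(X;Y)`
with `|𝓕(X;Y)| ≤ 24|X|²` — indeed `≤ 21|X|²` on `|X| < 1/3` — by a Cauchy estimate for `u ↦ log e^{uX}e^{Y}` (28); the
linear term's closed form `g^{−1}(−i ad_Y)X` of (36)–(38) stays the published [7, Thm. 2.14.3]; cell GAPS C-b07g8-1).  Phase-2 census rows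
C-B7-A … C-B7-F, N-B7-D144, N-B7-F1, N-B7-F2 (cell GAPS.md); divergences D-b07.1–4 (cell DIVERGENCE.md).  Edges to
earlier papers are definitional only: the averaging (14) = [Balaban1984PropagatorsI] (1.8) and the straight-line
operator Q of (125), (139) = ibid. (1.11) (`Setup.Averaging` / `Setup.LinAveraging` name these shapes; nothing of B5 is
used as a hypothesis in B7's proofs).  VALUE = typed skeleton + checked arithmetic, NOT summit progress.

Unit `b2b-balaban-b07` gen-5 revision (v5, DOCSTRING-ONLY: no declaration, statement or proof is touched).  Reading
notes recorded by later audit seats of the cell are attached to the statements they concern, each worded as the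
cell finding it is (cell GAPS ids), never as a fact about the paper beyond the located quotation: (122) «L(Q(V₀)A)_c»
= block size L times the L^{−(d+1)}-normalised linear form (124) (C-adv4-22); Prop. 4's (134)–(135) are printed in
the units L^kη = 1 (G-adv8-7 (iii)); the α₃-hypotheses of Props. 9–10 are not consumed by the printed proofs
(G-adv4-7); the sentence «The constant C′₁ depends on d and L» after (139) is sharp — a one-bond witness forces
C′₁ ≥ ((L−1)/L)²L^{d−2}/24 (finding of adv4-g7, G-adv4-6, with its constants corrected by this unit's independent
second engine, G-b07g5-1); and the printed linear form (124) coincides, to rounding, with the exact A-derivative of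
the definition (89)/(110)/(113)/(15) → (121) on random SU(2) data (C-b07g5-1; cell file
`b2b-balaban-b07/g5/qpp139.py`, numerical, not a Lean statement).  Two print slips located by adv4-g9
(G-adv4-8 (iii)) — (107) «Γ_{x_{l+1},x}» read Γ_{x_{l+1},x_l}, (98) last line «R^{j+1}_{0,c}» read R̄^{j+1}_{0,c} —
join the cell's misprint list G-B7-08.  VALUE = notation hygiene for consumers of (122)/(134)/(139)/(180),
NOT summit progress.

NORM (B7 (19) p. 21): |X| = operator norm of the matrix X; |U − 1| for group elements.  B9 uses the
normalised Hilbert–Schmidt norm instead (DIVERGENCE D-r1.1): the abstract `dev` fields below stand for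
whichever norm the citing paper fixes; cross-paper use needs the conversion factor c_N ∈ [1, √N].
-/

namespace Literature.MathematicalPhysics.QuantumFieldTheory.Balaban1983to89.B7

/-! ## One averaging step (Sect. B–C, Props 1–3) -/

/-- Abstract carrier of ONE averaging step V ↦ V̄ (B7 (9), (15) p. 19–20) on a fixed big plaquette
p′ of the L-lattice with its neighbourhood Δ(p′) = B(y₀) ∪ B(y₁) ∪ B(y₂) ∪ B(y) ((46), p. 25 [PDF 9]):
`plaqDev V` = sup over unit plaquettes p ⊂ Δ(p′) of |V(∂p) − 1| (hypothesis (44));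
`avgDev V` = |V̄(∂p′) − 1| (conclusion (51)).  For Prop. 3: `fldNorm A` = |A| (sup of the Lie-algebra
valued perturbation field of the perturbation V_{1,b} = e^{iA_b} of the background V₀, (109) p. 34 [PDF 18]),
`IsAnalyticQ V₀ r` = "Q(V₀, A) =
(1/i) log V̄₁ is an analytic function of A on |A| < r", `remC V₀ A` = |C(V₀, A, c)| of (122)–(123). [cite: Balaban1985Averaging, (9) + (15) + (44) pp.19–26] -/
structure OneStep where
  Cfg : Type
  Fld : Type
  plaqDev : Cfg → ℝ
  avgDev : Cfg → ℝ
  fldNorm : Fld → ℝ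
  IsAnalyticQ : Cfg → ℝ → Prop
  remC : Cfg → Fld → ℝ

/-- **Proposition 1** (p. 26 [PDF 10], verbatim): *"There exist positive constants C₀, c′₂ such that for every
configuration V satisfying (44) for p ⊂ Δ(p′) and for α₀ ≤ c′₂, we have
|V̄(∂p′) − 1| < L²α₀ + C₀(L²α₀)² (51).  The constant C₀ depends on d and c′₂ depends on d and L."*
Hypothesis (44): |V(∂p) − 1| < α₀ for p ⊂ Ω′ (here: for p ⊂ Δ(p′)).  Family index `I` = all
(torus, p′, V-independent data) for FIXED d and L; C₀, c′₂ chosen before `i`. [cite: Balaban1985Averaging, Prop. 1 (51) p.26] -/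
def Prop1Printed {I : Type} (L : ℝ) (fam : I → OneStep) : Prop :=
  ∃ C₀ c₂' : ℝ, 0 < C₀ ∧ 0 < c₂' ∧
    ∀ i : I, ∀ α₀ : ℝ, 0 < α₀ → α₀ ≤ c₂' → ∀ V : (fam i).Cfg,
      (fam i).plaqDev V < α₀ → (fam i).avgDev V < L ^ 2 * α₀ + C₀ * (L ^ 2 * α₀) ^ 2

/-- Abstract carrier of the k-FOLD average U ↦ Ū^k = M^k(U) on the η = L^{−k} lattice (B7 (9), p. 19):
`plaqDevEta U` = sup_{p ⊂ Ω} |U(∂p) − 1| · η^{−2} (hypothesis (52): |U(∂p) − 1| < α₀η²);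
`avgDevK U` = sup_{p ⊂ Ω^{(k)}} |Ū^k(∂p) − 1| (conclusion (54)). [cite: Balaban1985Averaging, (9) + (52) pp.19 + 26] -/
structure KStep where
  Cfg : Type
  k : ℕ
  plaqDevEta : Cfg → ℝ
  avgDevK : Cfg → ℝ

/-- **Proposition 2** (p. 26 [PDF 10], verbatim): *"If U satisfies (52) with α₀ ≤ c₂ = min{1/(3C₀), ½c′₂},
then |Ū^k(∂p) − 1| < α₀ + 2C₀α₀² < 2α₀, p ⊂ Ω^{(k)} (54)."*  (C₀, c′₂ = the constants of Prop. 1;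
uniform in k.  Locality remark p. 26: it suffices to assume (52) on the four k-blocks at the corners of p.) [cite: Balaban1985Averaging, Prop. 2 (54) p.26] -/
def Prop2Printed {I : Type} (C₀ c₂' : ℝ) (fam : I → KStep) : Prop :=
  ∀ i : I, ∀ α₀ : ℝ, 0 < α₀ → α₀ ≤ min (1 / (3 * C₀)) (c₂' / 2) → ∀ U : (fam i).Cfg,
    (fam i).plaqDevEta U < α₀ → (fam i).avgDevK U < α₀ + 2 * C₀ * α₀ ^ 2

/-- Census C-B7-2, kernel-checked arithmetic (i): under C₀α₀ ≤ ⅓ the printed bound α₀ + 2C₀α₀² is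
indeed < 2α₀ (last inequality of (54)). [folklore] -/
theorem prop2_bound_lt_two_alpha (C₀ α₀ : ℝ) (hα : 0 < α₀) (h : C₀ * α₀ ≤ 1 / 3) :
    α₀ + 2 * C₀ * α₀ ^ 2 < 2 * α₀ := by
  nlinarith [mul_pos hα hα]

/-- Census C-B7-2 (ii): the ratio of the geometric series in (53), L^{−2}(1 + C₀α₀)², is < ½ for L ≥ 2
and C₀α₀ ≤ ⅓ (indeed ≤ (16/9)/4 = 4/9), so the bracket in (53) is ≤ 2 — this is where "2C₀" comes from. [folklore] -/
theorem prop2_ratio_lt_half (C₀ α₀ L : ℝ) (hL : 2 ≤ L) (h0 : 0 ≤ C₀ * α₀) (h : C₀ * α₀ ≤ 1 / 3) :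
    (1 + C₀ * α₀) ^ 2 / L ^ 2 < 1 / 2 := by
  have hL2 : (4 : ℝ) ≤ L ^ 2 := by nlinarith
  have hnum : (1 + C₀ * α₀) ^ 2 ≤ 16 / 9 := by nlinarith
  rw [div_lt_iff₀ (by positivity)]
  nlinarith

/-- Census C-B7-2 (iii): geometric-series bookkeeping — if 0 ≤ r ≤ ½ then Σ_{i<j} r^i ≤ 2 for every j. [folklore] -/
theorem geom_bracket_le_two (r : ℝ) (h0 : 0 ≤ r) (h : r ≤ 1 / 2) (j : ℕ) :
    ∑ i ∈ Finset.range j, r ^ i ≤ 2 := by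
  have hr1 : r < 1 := by linarith
  calc ∑ i ∈ Finset.range j, r ^ i ≤ ∑' i, r ^ i :=
        (summable_geometric_of_lt_one h0 hr1).sum_le_tsum _ (fun i _ => pow_nonneg h0 i)
    _ = (1 - r)⁻¹ := tsum_geometric_of_lt_one h0 hr1
    _ ≤ 2 := by
        rw [inv_le_comm₀ (by linarith) (by norm_num)]
        linarith

/-- Bookkeeping used in (130)→(133), (163) and (204): for `L ≥ 2`, `η ≥ 0` and every `j`,
`Σ_{i<j} L^{i+1}η ≤ 2L^jη` (geometric tail with ratio `L⁻¹ ≤ ½`). [folklore] -/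
theorem sum_pow_succ_le (L η : ℝ) (hL : 2 ≤ L) (hη : 0 ≤ η) :
    ∀ j : ℕ, ∑ i ∈ Finset.range j, L ^ (i + 1) * η ≤ 2 * (L ^ j * η) := by
  intro j
  induction j with
  | zero => simp; positivity
  | succ j ih =>
      rw [Finset.sum_range_succ, pow_succ]
      have hLj : 0 ≤ L ^ j := pow_nonneg (by linarith) j
      have h2 : 2 * (L ^ j * η) ≤ L ^ j * L * η := by nlinarith [mul_nonneg hLj hη]
      linarith


/-- Levels below the unit scale: `L ≥ 1`, `η ≥ 0`, `L^kη ≤ 1` ⇒ `L^jη ≤ 1` for `j ≤ k` (with `η = L^{−k}`,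
`L^jη = L^{j−k}`). [folklore] -/
theorem level_le_one (L η : ℝ) (k : ℕ) (hL : 1 ≤ L) (hη : 0 ≤ η) (hk : L ^ k * η ≤ 1) :
    ∀ j ≤ k, L ^ j * η ≤ 1 := by
  intro j hj
  have h : L ^ j ≤ L ^ k := pow_le_pow_right₀ hL hj
  have := mul_le_mul_of_nonneg_right h hη
  linarith


/-- Unit b07, census C-B7-B: the algebra of the printed induction step (53)ⱼ ⇒ (53)ⱼ₊₁ (p. 26 [PDF 10]).
With `x = α₀(L^jη)²`, the bracket `S = 1 + L^{−2}(1+C₀α₀)² + …` (`0 ≤ S ≤ 2`) and `L²x ≤ α₀` (i.e. `j < k`),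
Proposition 1's bound at `P = x + C₀x²S` is dominated by the level-(j+1) form of (53):
`L²P + C₀(L²P)² ≤ L²x + C₀(L²x)²·(1 + L^{−2}(1+C₀α₀)²·S)`. [cite: Balaban1985Averaging, (53) p.26] -/
theorem step53_alg (L x α₀ C₀ S : ℝ) (hL : 2 ≤ L) (hC₀ : 0 < C₀) (hx : 0 < x) (hS0 : 0 ≤ S)
    (hS2 : S ≤ 2) (hxle : L ^ 2 * x ≤ α₀) :
    L ^ 2 * (x + C₀ * x ^ 2 * S) + C₀ * (L ^ 2 * (x + C₀ * x ^ 2 * S)) ^ 2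
      ≤ L ^ 2 * x + C₀ * (L ^ 2 * x) ^ 2 * (1 + (1 + C₀ * α₀) ^ 2 / L ^ 2 * S) := by
  have hL0 : 0 < L := by linarith
  have hL2 : (4 : ℝ) ≤ L ^ 2 := by nlinarith
  have hLne : L ^ 2 ≠ 0 := by positivity
  have hα : 0 ≤ α₀ := le_trans (by positivity) hxle
  have h2 : x * S ≤ α₀ := by nlinarith
  have k1 : 2 * C₀ ^ 2 * L ^ 4 * x ^ 3 * S ≤ 2 * C₀ ^ 2 * α₀ * L ^ 2 * x ^ 2 * S := by
    calc 2 * C₀ ^ 2 * L ^ 4 * x ^ 3 * S = (2 * C₀ ^ 2 * L ^ 2 * x ^ 2 * S) * (L ^ 2 * x) := by ring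
      _ ≤ (2 * C₀ ^ 2 * L ^ 2 * x ^ 2 * S) * α₀ := mul_le_mul_of_nonneg_left hxle (by positivity)
      _ = 2 * C₀ ^ 2 * α₀ * L ^ 2 * x ^ 2 * S := by ring
  have k2 : C₀ ^ 3 * L ^ 4 * x ^ 4 * S ^ 2 ≤ C₀ ^ 3 * α₀ ^ 2 * L ^ 2 * x ^ 2 * S := by
    have hprod : (L ^ 2 * x) * (x * S) ≤ α₀ * α₀ := mul_le_mul hxle h2 (by positivity) hα
    calc C₀ ^ 3 * L ^ 4 * x ^ 4 * S ^ 2 = (C₀ ^ 3 * L ^ 2 * x ^ 2 * S) * ((L ^ 2 * x) * (x * S)) := by ring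
      _ ≤ (C₀ ^ 3 * L ^ 2 * x ^ 2 * S) * (α₀ * α₀) := mul_le_mul_of_nonneg_left hprod (by positivity)
      _ = C₀ ^ 3 * α₀ ^ 2 * L ^ 2 * x ^ 2 * S := by ring
  have lhs_eq : L ^ 2 * (x + C₀ * x ^ 2 * S) + C₀ * (L ^ 2 * (x + C₀ * x ^ 2 * S)) ^ 2
      = L ^ 2 * x + C₀ * L ^ 4 * x ^ 2 +
        (C₀ * L ^ 2 * x ^ 2 * S + 2 * C₀ ^ 2 * L ^ 4 * x ^ 3 * S + C₀ ^ 3 * L ^ 4 * x ^ 4 * S ^ 2) := by ring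
  have rhs_eq : L ^ 2 * x + C₀ * (L ^ 2 * x) ^ 2 * (1 + (1 + C₀ * α₀) ^ 2 / L ^ 2 * S)
      = L ^ 2 * x + C₀ * L ^ 4 * x ^ 2 +
        (C₀ * L ^ 2 * x ^ 2 * S + 2 * C₀ ^ 2 * α₀ * L ^ 2 * x ^ 2 * S + C₀ ^ 3 * α₀ ^ 2 * L ^ 2 * x ^ 2 * S) := by
    field_simp
    ring
  rw [lhs_eq, rhs_eq]
  linarith


/-- **(53), kernel-checked induction** (p. 26 [PDF 10]; unit b07, census C-B7-B).  `a j` stands for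
`sup_{p ⊂ Ω^{(j)}} |Ū^j(∂p) − 1|`; `step` is Proposition 1 on the `L^jη`-lattice, as the printed proof applies it
("for j < k, we can apply Proposition 1 to the configuration Ū^j"): `a j < P`, `P ≤ c′₂` ⇒ `a (j+1) < L²P + C₀(L²P)²`.
Conclusion = the printed (53), `|Ū^j(∂p) − 1| < α₀(L^jη)² + C₀(α₀(L^jη)²)²[1 + L^{−2}(1+C₀α₀)² + … +
(L^{−2}(1+C₀α₀)²)^{j−1}]` for all `j ≤ k`, from (52) = `a 0 < α₀η²`, under the printed smallness
`α₀ ≤ c₂ = min{1/(3C₀), ½c′₂}` (as `C₀α₀ ≤ ⅓`, `2α₀ ≤ c′₂`); `η = L^{−k}` enters only as `L^kη ≤ 1`.  The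
identification of `step` with `Prop1Printed` applied to Ū^j (rescaling (9)–(10)) is carrier semantics (DIVERGENCE
D-b07.4). [cite: Balaban1985Averaging, (52)–(53) p.26] -/
theorem ineq53_induction (L η α₀ C₀ c₂' : ℝ) (k : ℕ) (a : ℕ → ℝ)
    (hL : 2 ≤ L) (hη : 0 < η) (hηk : L ^ k * η ≤ 1) (hC₀ : 0 < C₀) (hα : 0 < α₀)
    (hα3 : C₀ * α₀ ≤ 1 / 3) (hα2 : 2 * α₀ ≤ c₂')
    (h52 : a 0 < α₀ * η ^ 2)
    (step : ∀ j < k, ∀ P : ℝ, 0 < P → P ≤ c₂' → a j < P → a (j + 1) < L ^ 2 * P + C₀ * (L ^ 2 * P) ^ 2) :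
    ∀ j ≤ k, a j < α₀ * (L ^ j * η) ^ 2 +
      C₀ * (α₀ * (L ^ j * η) ^ 2) ^ 2 * ∑ i ∈ Finset.range j, ((1 + C₀ * α₀) ^ 2 / L ^ 2) ^ i := by
  have hL0 : 0 < L := by linarith
  have hL1 : (1 : ℝ) ≤ L := by linarith
  have hL2 : (4 : ℝ) ≤ L ^ 2 := by nlinarith
  have hr0 : 0 ≤ (1 + C₀ * α₀) ^ 2 / L ^ 2 := by positivity
  have hrhalf : (1 + C₀ * α₀) ^ 2 / L ^ 2 ≤ 1 / 2 :=
    (prop2_ratio_lt_half C₀ α₀ L hL (by positivity) hα3).le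
  intro j hj
  induction j with
  | zero =>
      simp only [pow_zero, one_mul, Finset.range_zero, Finset.sum_empty, mul_zero, add_zero]
      exact h52
  | succ j ih =>
      have hjk : j < k := Nat.lt_of_succ_le hj
      have ihj := ih (Nat.le_of_lt hjk)
      -- level-j data: t = L^j η, x = α₀ t², S = bracket
      have ht0 : 0 < L ^ j * η := by positivity
      have htL : L ^ (j + 1) * η ≤ 1 := level_le_one L η k hL1 hη.le hηk (j + 1) hj
      have hxle : L ^ 2 * (α₀ * (L ^ j * η) ^ 2) ≤ α₀ := by
        have h1 : L ^ 2 * (α₀ * (L ^ j * η) ^ 2) = α₀ * (L ^ (j + 1) * η) ^ 2 := by ring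
        have h2 : (L ^ (j + 1) * η) ^ 2 ≤ 1 := by
          have h3 : 0 ≤ L ^ (j + 1) * η := by positivity
          nlinarith
        rw [h1]; nlinarith
      have hx0 : 0 < α₀ * (L ^ j * η) ^ 2 := by positivity
      have hS0 : 0 ≤ ∑ i ∈ Finset.range j, ((1 + C₀ * α₀) ^ 2 / L ^ 2) ^ i :=
        Finset.sum_nonneg (fun i _ => pow_nonneg hr0 i)
      have hS2 : ∑ i ∈ Finset.range j, ((1 + C₀ * α₀) ^ 2 / L ^ 2) ^ i ≤ 2 := geom_bracket_le_two _ hr0 hrhalf j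
      -- P ≤ c'₂ : P = x(1 + C₀ x S) ≤ x (1 + 2/12) ≤ α₀ ≤ c'₂/2
      have hx4 : α₀ * (L ^ j * η) ^ 2 ≤ α₀ / 4 := by
        rw [le_div_iff₀ (by norm_num : (0:ℝ) < 4)]; nlinarith
      have hP0 : 0 < α₀ * (L ^ j * η) ^ 2 +
          C₀ * (α₀ * (L ^ j * η) ^ 2) ^ 2 * ∑ i ∈ Finset.range j, ((1 + C₀ * α₀) ^ 2 / L ^ 2) ^ i := by
        positivity
      have hPle : α₀ * (L ^ j * η) ^ 2 +
          C₀ * (α₀ * (L ^ j * η) ^ 2) ^ 2 * ∑ i ∈ Finset.range j, ((1 + C₀ * α₀) ^ 2 / L ^ 2) ^ i ≤ c₂' := by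
        have hCx : C₀ * (α₀ * (L ^ j * η) ^ 2) ≤ 1 / 12 := by
          nlinarith [mul_le_mul_of_nonneg_left hx4 hC₀.le]
        have : C₀ * (α₀ * (L ^ j * η) ^ 2) ^ 2 * ∑ i ∈ Finset.range j, ((1 + C₀ * α₀) ^ 2 / L ^ 2) ^ i
            ≤ α₀ * (L ^ j * η) ^ 2 := by
          have := mul_le_mul hCx hS2 hS0 (by norm_num)
          nlinarith [this, hx0]
        linarith
      have hstep := step j hjk _ hP0 hPle ihj
      -- rewrite the level-(j+1) target in terms of x and S
      have hx' : α₀ * (L ^ (j + 1) * η) ^ 2 = L ^ 2 * (α₀ * (L ^ j * η) ^ 2) := by ring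
      have hS' : ∑ i ∈ Finset.range (j + 1), ((1 + C₀ * α₀) ^ 2 / L ^ 2) ^ i
          = 1 + (1 + C₀ * α₀) ^ 2 / L ^ 2 * ∑ i ∈ Finset.range j, ((1 + C₀ * α₀) ^ 2 / L ^ 2) ^ i := by
        rw [Finset.sum_range_succ', pow_zero, Finset.mul_sum, add_comm]
        congr 1
        exact Finset.sum_congr rfl (fun i _ => by ring)
      rw [hx', hS']
      exact lt_of_lt_of_le hstep (step53_alg L _ α₀ C₀ _ hL hC₀ hx0 hS0 hS2 hxle)


/-- **Proposition 2 ⇐ Proposition 1, kernel-checked** (p. 26; C-B7-2, C-B7-B): "Taking j = k" in (53)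
(`L^kη = 1`) and bounding the bracket by 2 (`geom_bracket_le_two`, `prop2_ratio_lt_half`) gives (54):
`|Ū^k(∂p) − 1| < α₀ + 2C₀α₀²` — the conclusion of `Prop2Printed` from the one-step bound of `Prop1Printed`, at the
level of the numerical suprema. [cite: Balaban1985Averaging, Prop. 2 (53)–(54) p.26] -/
theorem prop2_of_ineq53 (L η α₀ C₀ c₂' : ℝ) (k : ℕ) (a : ℕ → ℝ)
    (hL : 2 ≤ L) (hη : 0 < η) (hηk : L ^ k * η = 1) (hC₀ : 0 < C₀) (hα : 0 < α₀)
    (hα3 : C₀ * α₀ ≤ 1 / 3) (hα2 : 2 * α₀ ≤ c₂')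
    (h52 : a 0 < α₀ * η ^ 2)
    (step : ∀ j < k, ∀ P : ℝ, 0 < P → P ≤ c₂' → a j < P → a (j + 1) < L ^ 2 * P + C₀ * (L ^ 2 * P) ^ 2) :
    a k < α₀ + 2 * C₀ * α₀ ^ 2 := by
  have h := ineq53_induction L η α₀ C₀ c₂' k a hL hη hηk.le hC₀ hα hα3 hα2 h52 step k le_rfl
  rw [hηk] at h
  simp only [one_pow, mul_one] at h
  have hr0 : 0 ≤ (1 + C₀ * α₀) ^ 2 / L ^ 2 := by positivity
  have hS := geom_bracket_le_two _ hr0 (prop2_ratio_lt_half C₀ α₀ L hL (by positivity) hα3).le k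
  have : C₀ * α₀ ^ 2 * ∑ i ∈ Finset.range k, ((1 + C₀ * α₀) ^ 2 / L ^ 2) ^ i ≤ 2 * C₀ * α₀ ^ 2 := by
    nlinarith [mul_le_mul_of_nonneg_left hS (by positivity : 0 ≤ C₀ * α₀ ^ 2)]
  linarith

/-- **Proposition 3** (p. 36 [PDF 20], verbatim): *"There exist constants C₁, c₃, c₃ ≤ c₂, such that for
α₀, α₁ ≤ c₃ the function Q(V₀, A) = (1/i) log V̄₁ is an analytic function of A satisfying the equalities and
bounds (122)–(124).  The constant C₁ depends on d and c₃ depends on d and L."*  (122): Q(V₀, A, c) =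
L(Q(V₀)A)_c + C(V₀, A, c); (123): |C(V₀, A, c)| ≤ C₁L²|A|² < C₁(Lα₁)²; (124) = the explicit linear form.
READING OF (122) (cell census C-adv4-22): «L(Q(V₀)A)_c» = L · (Q(V₀)A)_c with L the BLOCK SIZE (a scalar factor)
and Q(V₀)A the L^{−(d+1)}-normalised linear form (124) — not an operator «L = linear part»; cf. p. 37 [PDF 21]
«Q(U₀, ηA) − LηQ(U₀)A» and (150) p. 40 «Q_j(U₀, ηA) = L^jηQ_j(U₀)A + C_j(U₀, L^jηA)».  So the linear part of
Q(V₀, A, c) is L·(Q(V₀)A)_c and (126) bounds the L^{−(d+1)}-form.  The five-term formula (124) itself has been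
cross-checked against the definition (89)/(110)/(113)/(15) → (121) by exact differentiation on random SU(2)
backgrounds and fields, d = 2, 3, 4 (agreement to 3·10⁻¹⁵ relative; cell census C-b07g5-1, file
`b2b-balaban-b07/g5/qpp139.py`; numerical, not kernel-checked).
GAPS G-B7-02: analyticity domain and (123) asserted as "obvious"; C₁ never tracked. [cite: Balaban1985Averaging, Prop. 3 (122)–(123) p.36] -/
def Prop3Printed {I : Type} (L c₂ : ℝ) (fam : I → OneStep) : Prop :=
  ∃ C₁ c₃ : ℝ, 0 < C₁ ∧ 0 < c₃ ∧ c₃ ≤ c₂ ∧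
    ∀ i : I, ∀ α₀ α₁ : ℝ, 0 < α₀ → α₀ ≤ c₃ → 0 < α₁ → α₁ ≤ c₃ → ∀ V₀ : (fam i).Cfg,
      (fam i).plaqDev V₀ < α₀ →
        (fam i).IsAnalyticQ V₀ α₁ ∧
        ∀ A : (fam i).Fld, (fam i).fldNorm A < α₁ → (fam i).remC V₀ A ≤ C₁ * L ^ 2 * (fam i).fldNorm A ^ 2

/-! ## k-fold expansions (Sect. D, Props 4–7) -/

/-- Abstract carrier for Props 4–7: a background U₀ on the η-lattice with (52)-deviation `plaqDevEta`,
perturbation fields A (U₁ = e^{iηA}) with sup norm `fldNorm`, the k-fold function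
Q_k(U₀, ηA, c) = (1/i) log (Ū₁^k)_c (127) with remainder C_k(U₀, A) of (134), its functional derivatives
(156)–(157), and the complex-perturbed background U′U₀, U′ = e^{iηA′} (158).  Family convention (as for
`Prop1Printed`; DIVERGENCE D-pv14.2): in `Prop4Printed`–`Prop7Printed` the index `i : I` ranges over data for
FIXED d and L (print, p. 39 [PDF 23]: "The constants C₂, c₄ are independent of k, C₂ depends on d and c₄
depends on d and L.", "The constant C′₁ depends on d and L."; p. 40 [PDF 24]: "The constant C″₁ depends on d
and L."), the constants being chosen before `i`; nothing L-uniform is asserted.  (On (139) p. 39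
«∣Q″(V₀)A∣ ≤ C′₁L²α₀Q″∣A∣»: the L-dependence of C′₁ is genuine — for G ⊇ SU(2), d ≥ 3, a field supported on the
single tree-path bond [c₋, c₋ + e_d] in a background of (1,2)-curvature α₀(1 − x_d/(3L))σ₃/2 forces
C′₁ ≥ ((L−1)/L)²L^{d−2}/24 · (1 + O(L²α₀)), because that bond lies on (L−1)L^{d−1} of the L^d tree paths while
Q″ weighs it L^{−d}; finding of adv4-g7 (cell census G-adv4-6) with the constants as corrected by the independent
second engine of b07-g5 (G-b07g5-1: G-adv4-6's «(7/192)L^{d−2}, limit ¼» read «L^{d−2}/96, limit 1/24»);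
numerical/first-order, not kernel-checked; consumers: (145)–(147), (156).) [cite: Balaban1985Averaging, (52) + (133) pp.26 + 38] -/
structure KExp where
  Cfg : Type
  Fld : Type
  k : ℕ
  plaqDevEta : Cfg → ℝ
  fldNorm : Fld → ℝ
  /-- "Q_k(U₀, ηA, c) is an analytic function of the variables A_b, b ⊂ B^k(c₋) ∪ B^k(c₊)" on |A| < r -/
  IsAnalyticQk : Cfg → ℝ → Prop
  /-- |C_k(U₀, A)| (sup over c ⊂ Ω^{(k)}) -/
  remCk : Cfg → Fld → ℝ
  /-- sup_b |δ/δA_b Q_k(U₀, ηA, c)| and sup_b |δ/δA_b C_k(U₀, A, c)| -/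
  dQk : Cfg → Fld → ℝ
  dCk : Cfg → Fld → ℝ
  /-- complex perturbation of the background: `pert U₀ A′` = U′U₀ with U′ = e^{iηA′}, A′ 𝔤ᶜ-valued -/
  pert : Cfg → Fld → Cfg
  /-- |U′U₀‾^k (Ū₀^k)^{−1} − 1| (sup over bonds of Ω^{(k)}), conclusion (164) -/
  avgRatioDev : Cfg → Fld → ℝ
  /-- "Q_k(U′U₀, ηA) is analytic in complex variables A′, A" on |A′| < r′, |A| < r -/
  IsJointlyAnalytic : Cfg → ℝ → ℝ → Prop

/-- **Proposition 4** (pp. 38–39 [PDF 22–23], verbatim): *"There exist constants C₂, c₄ such that for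
α₀, α₁ ≤ c₄ the function Q_k(U₀, ηA, c) = (1/i) log(Ū₁^k)_c, c ⊂ Ω^{(k)}, is an analytic function of the
variables A_b, b ⊂ B^k(c₋) ∪ B^k(c₊).  Further we have Q_k(U₀, ηA) = Q_k(U₀)A + C_k(U₀, A), (134) and
|C_k(U₀, A)| ≤ C₂|A|² < C₂α₁². (135)  The constants C₂, c₄ are independent of k, C₂ depends on d and c₄
depends on d and L. …"*  (C₂ = e^{O(1)2α₀}8C₁ by (133).)  READING (cell census G-adv8-7 (iii)): (134)–(135)
are printed in the units in which the k-th lattice is the unit lattice, L^kη = 1; with the scales written out,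
(130) p. 37, (150) p. 40 and B9 (3.14) read Q_k(U₀, ηA) = L^kη·Q_k(U₀)A + C_k(U₀, L^kηA) (harmless: B9 copies
(150)'s form; the abstract `remCk` below is |C_k| in whichever units the citing paper fixes). [cite: Balaban1985Averaging, Prop. 4 (134)–(135) pp.38–39] -/
def Prop4Printed {I : Type} (fam : I → KExp) : Prop :=
  ∃ C₂ c₄ : ℝ, 0 < C₂ ∧ 0 < c₄ ∧
    ∀ i : I, ∀ α₀ α₁ : ℝ, 0 < α₀ → α₀ ≤ c₄ → 0 < α₁ → α₁ ≤ c₄ → ∀ U₀ : (fam i).Cfg,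
      (fam i).plaqDevEta U₀ < α₀ →
        (fam i).IsAnalyticQk U₀ α₁ ∧
        ∀ A : (fam i).Fld, (fam i).fldNorm A < α₁ → (fam i).remCk U₀ A ≤ C₂ * (fam i).fldNorm A ^ 2

/-- `e^{1/3} < 3/2` (as `(3/2)³ = 27/8 > e`); feeds the closing inequality of (131). [folklore] -/
theorem exp_third_lt : Real.exp (1 / 3) < 3 / 2 := by
  have h3 : Real.exp (1 / 3) ^ 3 = Real.exp 1 := by
    rw [← Real.exp_nat_mul]; norm_num
  have he : Real.exp 1 < 2.7182818286 := Real.exp_one_lt_d9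
  by_contra hcon
  push Not at hcon
  have h27 : (3 / 2 : ℝ) ^ 3 ≤ Real.exp (1 / 3) ^ 3 := pow_le_pow_left₀ (by norm_num) hcon 3
  rw [h3] at h27
  norm_num at h27
  linarith


/-- **(131), closing inequality** (p. 38 [PDF 22]; census C-B7-D): with the printed sample smallness
"O(1)α₀ ≤ 1/6, 8C₁α₁ ≤ 1/3" (`K` = the absolute constant written O(1)),
`e^{O(1)2α₀}(1 + 8C₁α₁)α₁ ≤ e^{1/3}(4/3)α₁ < 2α₁` — the bound `|Q_j(U₀, ηA)| < 2α₁L^jη` of (131) after division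
by `L^jη`. [cite: Balaban1985Averaging, (131) p.38] -/
theorem ineq131_closure (K C₁ α₀ α₁ : ℝ) (hα₁ : 0 < α₁) (hC : 0 ≤ C₁)
    (h₀ : K * α₀ ≤ 1 / 6) (h₁ : 8 * C₁ * α₁ ≤ 1 / 3) :
    Real.exp (K * (2 * α₀)) * (1 + 8 * C₁ * α₁) * α₁ < 2 * α₁ := by
  have hexp : Real.exp (K * (2 * α₀)) ≤ Real.exp (1 / 3) := Real.exp_le_exp.mpr (by linarith)
  have h32 := exp_third_lt
  have hlt : Real.exp (K * (2 * α₀)) * (1 + 8 * C₁ * α₁) < 2 := by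
    calc Real.exp (K * (2 * α₀)) * (1 + 8 * C₁ * α₁)
        ≤ Real.exp (1 / 3) * (4 / 3) :=
          mul_le_mul hexp (by linarith) (by positivity) (Real.exp_pos _).le
      _ < 3 / 2 * (4 / 3) := by nlinarith
      _ = 2 := by norm_num
  nlinarith


/-- **(130), kernel-checked induction** (pp. 37–38 [PDF 21–22]; census C-B7-D).  `D j` stands for
`|(L^jη)^{−1}Q_j(U₀, ηA) − Q_j(U₀)A|` (sup over c ⊂ Ω^{(j)}), `D 0 = 0`; `step` is the printed step: (132)
[= Proposition 3 on the `L^jη`-lattice at the point `Q_j(U₀, ηA)`, admissible by (131)] contributes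
`4C₁L^{j+1}ηα₁²`, and the linear part `LQ(Ū₀^j)` transports the previous difference with the factor
`e^{O(1)L²(L^jη)²α₀}` of (126) (background regularity `< 2α₀(L^jη)²` by (53)–(54)); `K ≥ 0` = the absolute O(1).
Conclusion = (130) for `1 ≤ j ≤ k`:
`D j < exp(O(1)(L^{2j} + … + L²)η²α₀)·4C₁(L^j + … + L)ηα₁²`. [cite: Balaban1985Averaging, (128)–(132) pp.37–38] -/
theorem ineq130_induction (K C₁ L η α₀ α₁ : ℝ) (k : ℕ) (D : ℕ → ℝ)
    (hK : 0 ≤ K) (hC₁ : 0 ≤ C₁) (hL : 0 ≤ L) (hη : 0 ≤ η) (hα₀ : 0 ≤ α₀)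
    (hD0 : D 0 = 0)
    (step : ∀ j < k, D (j + 1) < 4 * C₁ * (L ^ (j + 1) * η) * α₁ ^ 2 +
        Real.exp (K * (L ^ (j + 1) * η) ^ 2 * α₀) * D j) :
    ∀ j ≤ k, 1 ≤ j → D j < Real.exp (K * (∑ i ∈ Finset.range j, (L ^ (i + 1) * η) ^ 2) * α₀) *
        (4 * C₁ * (∑ i ∈ Finset.range j, L ^ (i + 1) * η) * α₁ ^ 2) := by
  intro j hj hj1
  induction j with
  | zero => exact absurd hj1 (by norm_num)
  | succ j ih =>
      have hjk : j < k := Nat.lt_of_succ_le hj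
      have hs := step j hjk
      have hT : 0 ≤ 4 * C₁ * (L ^ (j + 1) * η) * α₁ ^ 2 := by positivity
      have he1 : 1 ≤ Real.exp (K * (L ^ (j + 1) * η) ^ 2 * α₀) := Real.one_le_exp (by positivity)
      -- the old bound (zero if j = 0)
      have hold : D j ≤ Real.exp (K * (∑ i ∈ Finset.range j, (L ^ (i + 1) * η) ^ 2) * α₀) *
          (4 * C₁ * (∑ i ∈ Finset.range j, L ^ (i + 1) * η) * α₁ ^ 2) := by
        rcases Nat.eq_zero_or_pos j with hj0 | hjpos
        · subst hj0; simp [hD0]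
        · exact (ih (Nat.le_of_lt hjk) hjpos).le
      have hE1 : 1 ≤ Real.exp (K * (∑ i ∈ Finset.range j, (L ^ (i + 1) * η) ^ 2) * α₀) :=
        Real.one_le_exp (by positivity)
      have hSg0 : 0 ≤ ∑ i ∈ Finset.range j, L ^ (i + 1) * η := Finset.sum_nonneg (fun i _ => by positivity)
      have hEsucc : Real.exp (K * (∑ i ∈ Finset.range (j + 1), (L ^ (i + 1) * η) ^ 2) * α₀)
          = Real.exp (K * (∑ i ∈ Finset.range j, (L ^ (i + 1) * η) ^ 2) * α₀) *
            Real.exp (K * (L ^ (j + 1) * η) ^ 2 * α₀) := by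
        rw [← Real.exp_add, Finset.sum_range_succ]; ring_nf
      rw [hEsucc, Finset.sum_range_succ]
      -- abbreviate
      generalize hE : Real.exp (K * (∑ i ∈ Finset.range j, (L ^ (i + 1) * η) ^ 2) * α₀) = E at *
      generalize he : Real.exp (K * (L ^ (j + 1) * η) ^ 2 * α₀) = e₁ at *
      generalize hSg : ∑ i ∈ Finset.range j, L ^ (i + 1) * η = Sg at *
      generalize hTT : 4 * C₁ * (L ^ (j + 1) * η) * α₁ ^ 2 = T at *
      have hD' : 0 ≤ 4 * C₁ * Sg * α₁ ^ 2 := by positivity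
      have h1 : e₁ * D j ≤ e₁ * (E * (4 * C₁ * Sg * α₁ ^ 2)) :=
        mul_le_mul_of_nonneg_left hold (by linarith)
      have hEe : (1 : ℝ) ≤ E * e₁ := one_le_mul_of_one_le_of_one_le hE1 he1
      have h2 : T ≤ E * e₁ * T := by nlinarith
      have hTdef : T = 4 * C₁ * (L ^ (j + 1) * η) * α₁ ^ 2 := hTT.symm
      calc D (j + 1) < T + e₁ * D j := hs
        _ ≤ E * e₁ * T + e₁ * (E * (4 * C₁ * Sg * α₁ ^ 2)) := add_le_add h2 h1
        _ = E * e₁ * (4 * C₁ * (Sg + L ^ (j + 1) * η) * α₁ ^ 2) := by rw [hTdef]; ring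


/-- **(133) ⇐ (130) at j = k** (p. 38; census C-B7-D): for `L ≥ 2`, `L^kη = 1` both geometric sums are `≤ 2`
(`sum_pow_succ_le`), hence `|Q_k(U₀, ηA) − Q_k(U₀)A| < e^{O(1)2α₀}·8C₁α₁² = C₂α₁²` — the printed value
`C₂ = e^{O(1)2α₀}8C₁` of the constant of Proposition 4 (135), independent of k. [cite: Balaban1985Averaging, (133) p.38] -/
theorem ineq133_of_130 (K C₁ L η α₀ α₁ Dk : ℝ) (k : ℕ)
    (hK : 0 ≤ K) (hC₁ : 0 ≤ C₁) (hL : 2 ≤ L) (hη : 0 < η) (hηk : L ^ k * η = 1) (hα₀ : 0 ≤ α₀)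
    (h130 : Dk < Real.exp (K * (∑ i ∈ Finset.range k, (L ^ (i + 1) * η) ^ 2) * α₀) *
        (4 * C₁ * (∑ i ∈ Finset.range k, L ^ (i + 1) * η) * α₁ ^ 2)) :
    Dk < Real.exp (K * (2 * α₀)) * (8 * C₁) * α₁ ^ 2 := by
  have hL0 : 0 < L := by linarith
  have hs1 : ∑ i ∈ Finset.range k, L ^ (i + 1) * η ≤ 2 := by
    have := sum_pow_succ_le L η hL hη.le k
    rw [hηk] at this; linarith
  have hs2 : ∑ i ∈ Finset.range k, (L ^ (i + 1) * η) ^ 2 ≤ 2 := by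
    have h := sum_pow_succ_le (L ^ 2) (η ^ 2) (by nlinarith) (by positivity) k
    have hrw : ∀ i : ℕ, (L ^ (i + 1) * η) ^ 2 = (L ^ 2) ^ (i + 1) * η ^ 2 := by
      intro i; ring
    simp_rw [hrw]
    have hk2 : (L ^ 2) ^ k * η ^ 2 = 1 := by
      have : (L ^ 2) ^ k * η ^ 2 = (L ^ k * η) ^ 2 := by ring
      rw [this, hηk]; norm_num
    rw [hk2] at h; linarith
  have hexp : Real.exp (K * (∑ i ∈ Finset.range k, (L ^ (i + 1) * η) ^ 2) * α₀)
      ≤ Real.exp (K * (2 * α₀)) := by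
    apply Real.exp_le_exp.mpr
    have := mul_le_mul_of_nonneg_left hs2 hK
    nlinarith [mul_le_mul_of_nonneg_right this hα₀]
  have hrest : 4 * C₁ * (∑ i ∈ Finset.range k, L ^ (i + 1) * η) * α₁ ^ 2 ≤ 8 * C₁ * α₁ ^ 2 := by
    nlinarith [mul_le_mul_of_nonneg_left hs1 (by positivity : 0 ≤ 4 * C₁ * α₁ ^ 2)]
  calc Dk < _ := h130
    _ ≤ Real.exp (K * (2 * α₀)) * (8 * C₁ * α₁ ^ 2) :=
        mul_le_mul hexp hrest (by positivity) (Real.exp_pos _).le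
    _ = Real.exp (K * (2 * α₀)) * (8 * C₁) * α₁ ^ 2 := by ring

/-- **Proposition 5** (p. 42 [PDF 26], verbatim): *"The functional derivative of Q_k(U₀, ηA) is a bounded
function for α₀, α₁ sufficiently small, and we have the bounds
|δ/δA_b Q_k(U₀, ηA, c)| ≤ 1 + 2C′₁α₀ + C₃|A| < 1 + 2C′₁α₀ + C₃α₁, (156)
|δ/δA_b C_k(U₀, A, c)| ≤ C₃|A| < C₃α₁. (157)"*  (C₃ = 6C″₁; "sufficiently small" = (155), typed as an
unspecified threshold c₅ chosen before the instance.  Notation clash G-B7-06: the C₃ of (170) is another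
constant.) [cite: Balaban1985Averaging, Prop. 5 (156)–(157) p.42] -/
def Prop5Printed {I : Type} (fam : I → KExp) : Prop :=
  ∃ C₁' C₃ c₅ : ℝ, 0 < C₁' ∧ 0 < C₃ ∧ 0 < c₅ ∧
    ∀ i : I, ∀ α₀ α₁ : ℝ, 0 < α₀ → α₀ ≤ c₅ → 0 < α₁ → α₁ ≤ c₅ → ∀ U₀ : (fam i).Cfg,
      (fam i).plaqDevEta U₀ < α₀ → ∀ A : (fam i).Fld, (fam i).fldNorm A < α₁ →
        (fam i).dQk U₀ A ≤ 1 + 2 * C₁' * α₀ + C₃ * (fam i).fldNorm A ∧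
        (fam i).dCk U₀ A ≤ C₃ * (fam i).fldNorm A

/-- G-B7-03, kernel-checked: with the sample choices of p. 42 (4dC′₁α₀L^{−1} ≤ ⅓,
(C₂ + 2dC₃)L^{−1}α₁ ≤ ⅔ and the factor 1/6) the left side of (155) is ≤ ⅓ + (1/6)(11/6)² < 1. [folklore] -/
theorem ineq155_sample : (1 : ℝ) / 3 + 1 / 6 * (11 / 6) ^ 2 < 1 := by norm_num

/-- **(145)** (p. 40 [PDF 24]; census C-B7-D, note N-B7-D144): for `L ≥ 2` the bracket
`2L^{−2} + L^{−2} + 4dC′₁α₀L^{−4}` of (145) is `≤ 1` as soon as `16dC′₁α₀ ≤ L⁴` ("if α₀ is sufficiently small"),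
closing the induction (143)ⱼ ⇒ (143)ⱼ₊₁ via (144). [cite: Balaban1985Averaging, (143)–(145) p.40] -/
theorem ineq145_bracket (L d C₁' α₀ : ℝ) (hL : 2 ≤ L) (h : 16 * d * C₁' * α₀ ≤ L ^ 4) :
    2 / L ^ 2 + 1 / L ^ 2 + 4 * d * C₁' * α₀ / L ^ 4 ≤ 1 := by
  have hL2 : (4 : ℝ) ≤ L ^ 2 := by nlinarith
  have hL4 : (0 : ℝ) < L ^ 4 := by positivity
  have h1 : 2 / L ^ 2 + 1 / L ^ 2 ≤ 3 / 4 := by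
    rw [← add_div, div_le_div_iff₀ (by positivity) (by norm_num)]; nlinarith
  have h2 : 4 * d * C₁' * α₀ / L ^ 4 ≤ 1 / 4 := by
    rw [div_le_div_iff₀ hL4 (by norm_num)]; nlinarith [h]
  linarith

/-- **Proposition 6** (p. 43 [PDF 27], verbatim): *"If U₀ satisfies (52), then U′U₀‾^k is an analytic
function of A′ = (1/(iη)) log U′ for A′ with values in the complexified algebra, and satisfying |A′| < α₁.
Moreover, we have a bound |U′U₀‾^k (Ū₀^k)^{−1} − 1| < O(1)α₁. (164)  Of course, we assume that α₀, α₁ are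
sufficiently small."*  GAPS G-B7-05 (phase-1 OBJECTION): the proof ("easily incorporated") re-uses the Sect. B–D
estimates, stated for unitary backgrounds via (24)–(25), on the complex configuration Ũ′^jŪ₀^j; they
survive with (26)–(27) (constant 2) but the changed constants are not stated.  Phase 2 (unit b07, C-B7-E;
consistent with C-A7-1): the proof of THIS proposition is the printed chain (159)–(163) — (159) = the identity (97)
with U₁ → U′, (161) = (131)/Prop. 4 for the complex field A′ over the UNITARY background U₀ (the stated scope of
Props. 3–4: (110) takes A ∈ 𝔤ᶜ), (162)–(163) group arithmetic — and is CERTIFIED step by step; the kernel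
arithmetic of (162)–(164) (uniform-in-k, linear-in-α₁ O(1)) is `B7Prop6Bound.lean`.  The "easily incorporated"
sentence of p. 43 is the proof of Prop. 7 and of the Prop. 5 extension (complex BACKGROUND U′U₀): see
`Prop7Printed`. [cite: Balaban1985Averaging, Prop. 6 (164) p.43] -/
def Prop6Printed {I : Type} (fam : I → KExp) : Prop :=
  ∃ O₁ c : ℝ, 0 < O₁ ∧ 0 < c ∧
    ∀ i : I, ∀ α₀ α₁ : ℝ, 0 < α₀ → α₀ ≤ c → 0 < α₁ → α₁ ≤ c → ∀ U₀ : (fam i).Cfg,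
      (fam i).plaqDevEta U₀ < α₀ → ∀ A' : (fam i).Fld, (fam i).fldNorm A' < α₁ →
        (fam i).avgRatioDev U₀ A' < O₁ * α₁

/-- **Proposition 7** (p. 43 [PDF 27], verbatim): *"For U₀ satisfying (52) and U′ = e^{iηA′}, |A′| < α₁,
α₀, α₁ sufficiently small, the function Q_k(U′U₀, ηA) is analytic in complex variables A′, A, and
Proposition 4 holds uniformly in A′."*  Census G-B7-05 ("This change is easily incorporated … Similarly,
Proposition 5 may be extended … The formulations are obvious."): phase 2 (unit b07, C-B7-E) certifies it as a
PROOF-BY-MODIFICATION whose modifications are the finite list (a) (24)–(25) → (26)–(27) (constants π/2, 1 → 2, 2,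
valid for |X − 1| ≤ ½); (b) |R(W)A| = |A| → |R(W)A| ≤ |W||W⁻¹||A| ≤ e^{O(1)Lα₁}|A| for the non-unitary transports
W = (V′V₀)(Γ), |Γ| = O(dL); (c) additivity |W₁W₂ − 1| ≤ |W₁ − 1| + |W₂ − 1| → Π(1 + aᵢ) − 1 ≤ e^{Σaᵢ} − 1;
(d) second-order remainder ½S² → e^S − 1 − S; (e) NO complex version of Props. 1–2 is needed: the background
averages (U′U₀)‾^j = Ũ′^jŪ₀^j are controlled by (164) at level j ((161)–(163)), i.e. by Prop. 4 for U′ over the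
unitary U₀ — a bootstrap, not a new estimate.  Resulting constants: in (126) e^{O(1)L²α₀} → e^{O(1)(L²α₀+Lα₁)}
(|Y_x| = O(L²α₀ + Lα₁)); in (128)–(133) the factors e^{O(1)L^{2(j+1)}η²α₀} → e^{O(1)(L^{2(j+1)}η²α₀ + L^{j+1}ηα₁)},
Σ_j ≤ O(1)(2α₀ + 2α₁) uniform in k; C₂ → e^{O(1)2(α₀+α₁)}8C₁′ with C₁′ the Prop-3 constant for the enlarged |Y_x|.
[cite: Balaban1985Averaging, Prop. 7 p.43] -/
def Prop7Printed {I : Type} (fam : I → KExp) : Prop :=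
  ∃ C₂ c : ℝ, 0 < C₂ ∧ 0 < c ∧
    ∀ i : I, ∀ α₀ α₁ : ℝ, 0 < α₀ → α₀ ≤ c → 0 < α₁ → α₁ ≤ c → ∀ U₀ : (fam i).Cfg,
      (fam i).plaqDevEta U₀ < α₀ →
        (fam i).IsJointlyAnalytic U₀ α₁ α₁ ∧
        ∀ A' A : (fam i).Fld, (fam i).fldNorm A' < α₁ → (fam i).fldNorm A < α₁ →
          (fam i).remCk ((fam i).pert U₀ A') A ≤ C₂ * (fam i).fldNorm A ^ 2

/-! ## Gauge transformations (Sect. E, Props 8–10) -/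

/-- Abstract carrier for Props 8–10: gauge transformations u on Ω relative to a background U₀ satisfying
(52) (`plaqDevEta`); `InLambda U₀ α₃ u` = u ∈ Λ_k(U₀, α₃), the class (166)–(167) p. 44; `mul` = pointwise
product u₁u₂; `Reg176 α₄ u′` = (176)–(177): |u′(x) − 1| < α₄, |u′^{−1}(b₋)R_{0,b}u′(b₊) − 1| < α₄η;
`avgDev203 U₀ u₁ u′ j` and `avgDev204 U₀ u₁ u′ j` = the left sides of (203), (204) for the averages
ũ′^j = R₀u′u₁‾^j (R₀u₁‾^j)^{−1} (178), maximised over c ⊂ Ω^{(j)}, resp. y ∈ Ω^{(j)}.  Family convention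
(DIVERGENCE D-pv14.2): in `Prop8Printed` and `Prop10Printed` the index `i : I` ranges over data for FIXED d and
L, i.e. `(fam i).L = L` for one L (as `Prop9Printed` makes explicit by hoisting `L`); the constants are chosen
before `i` and nothing L-uniform is asserted. [cite: Balaban1985Averaging, (176)–(177) p.44] -/
structure GaugeData where
  Cfg : Type
  GT : Type
  k : ℕ
  eta : ℝ
  L : ℝ
  plaqDevEta : Cfg → ℝ
  InLambda : Cfg → ℝ → GT → Prop
  mul : GT → GT → GT
  Reg176 : ℝ → GT → Prop
  avgDev203 : Cfg → GT → GT → ℕ → ℝ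
  avgDev204 : Cfg → GT → GT → ℕ → ℝ

/-- **Proposition 8** (p. 45 [PDF 29], verbatim): *"If u₁, u₂ ∈ Λ_k(U₀, α₃) and α₃ is sufficiently small,
i.e., α₃ ≤ c₆ for some c₆, then u = u₁u₂ ∈ Λ_k(U₀, 2α₃ + 2C₃α₃²) and we have (173)."*
(C₃ here = the constant of (170), G-B7-06; the recursion (171)–(173) is kernel-checked below, `ineq173_recursion`.
No hypothesis (52) on U₀ appears: Λ_k(U₀, α₃) (p. 44) is defined for any background and the proof uses only
unitarity of the transports, DIVERGENCE D-b07.3.) [cite: Balaban1985Averaging, Prop. 8 (173)–(175) p.45] -/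
def Prop8Printed {I : Type} (fam : I → GaugeData) : Prop :=
  ∃ C₃ c₆ : ℝ, 0 < C₃ ∧ 0 < c₆ ∧
    ∀ i : I, ∀ α₃ : ℝ, 0 < α₃ → α₃ ≤ c₆ → ∀ U₀ : (fam i).Cfg, ∀ u₁ u₂ : (fam i).GT,
      (fam i).InLambda U₀ α₃ u₁ → (fam i).InLambda U₀ α₃ u₂ →
        (fam i).InLambda U₀ (2 * α₃ + 2 * C₃ * α₃ ^ 2) ((fam i).mul u₁ u₂)

/-- **(171)–(173), kernel-checked recursion** (p. 45 [PDF 29]; census C-B7-F): with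
`s j = sup_{x_j} |r_j(x_j)| / (C₃(α₃L^jη)²)`, (171) reads `s 1 ≤ 1`, the step (172)→(173) reads `s (j+1) ≤ 1 + q·s j`
with `q = L^{−2}(1 + C₃α₃)²`, and `q ≤ ½` ("α₃ sufficiently small"; cf. `prop2_ratio_lt_half` with (C₃, α₃) for
(C₀, α₀)) gives the printed bracket bound `1 + q + … + q^{j−1} < 2` of (173), i.e. `|r_j(x_j)| < 2C₃(α₃L^jη)²`, the
input of (174)–(175) and Proposition 8. [cite: Balaban1985Averaging, (171)–(173) p.45] -/
theorem ineq173_recursion (q : ℝ) (s : ℕ → ℝ) (hq0 : 0 ≤ q) (hq : q ≤ 1 / 2)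
    (h1 : s 1 ≤ 1) (hstep : ∀ j, 1 ≤ j → s (j + 1) ≤ 1 + q * s j) :
    ∀ j, 1 ≤ j → s j < 2 := by
  intro j hj
  induction j with
  | zero => exact absurd hj (by norm_num)
  | succ j ih =>
      rcases Nat.eq_zero_or_pos j with hj0 | hjpos
      · subst hj0; linarith
      · have hs := hstep j hjpos
        have ihj := ih hjpos
        nlinarith [mul_le_mul_of_nonneg_left ihj.le hq0]

/-- Abstract carrier of the ONE-STEP data of Sect. F (p. 46 [PDF 30]) behind Proposition 9: a background `V₀`
on the unit lattice Ω′ with `plaqDev V₀` = sup_p |V₀(∂p) − 1| (< α₀); a 𝐆ᶜ-valued regular function `v′`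
(possibly non-unitary: u′ = e^{iλ}, λ ∈ 𝔤ᶜ, p. 45) with `dev v′` = sup_y |v′(y) − 1| (< α₄) and
`covDev V₀ v′` = sup_b |v′^{−1}(b₋)R_{0,b}v′(b₊) − 1| (< α′₄); a gauge transformation `v₁` with `dev v₁` (< α₃) and
`blockCovDev V₀ v₁` = sup_{y, x ∈ B(y)} |v₁^{−1}(y)(R₀v₁)(x) − 1| (< Lα′₃) — the four conditions (180); and, for the
one-step average ṽ′ = (R₀v′v₁)‾((R₀v₁)‾)^{−1} ((178)–(179)), `avgCovDev V₀ v₁ v′` = sup_c |ṽ′^{−1}(c₋)R̄_{0,c}ṽ′(c₊) − 1|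
(left side of (199)) and `avgDev V₀ v₁ v′` = sup_y |ṽ′(y) − 1| (left side of (200)). [cite: Balaban1985Averaging, (178)–(180) pp.45–46] -/
structure GaugeOneStep where
  Cfg : Type
  GT : Type
  plaqDev : Cfg → ℝ
  dev : GT → ℝ
  covDev : Cfg → GT → ℝ
  blockCovDev : Cfg → GT → ℝ
  avgCovDev : Cfg → GT → GT → ℝ
  avgDev : Cfg → GT → GT → ℝ

/-- **Proposition 9** (p. 49 [PDF 33], verbatim): *"There exist positive constants C′₄, C′₅, c′₆ such that for
arbitrary functions V₀, v′, v₁ satisfying (180) with α₀, α₃, α′₃, α₄, α′₄ ≤ c′₆, the following bounds hold: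
|ṽ′^{−1}(c₋)R̄_{0,c}ṽ′(c₊) − 1| < Lα′₄ + C′₄L²(α₀α₄ + α′₃α′₄ + α′₄²), (199)
|ṽ′(y) − 1| < α₄ + C′₅Lα′₄. (200)
In these bounds we have assumed that α′₄ = O(α₄), which will always be true here and in forthcoming papers."*
The proviso "α′₄ = O(α₄)" (it absorbs the `α₀α′₄` term of (197) into `C′₄L²α₀α₄`) is typed as an explicit ratio
bound `α′₄ ≤ Mα₄`, the constants being allowed to depend on `M` (DIVERGENCE D-b07.1; the application (205) has
`M = 2`).  The dependence of C′₄, C′₅, c′₆ on d and L is not stated in print (c′₆ may depend on L through (198);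
notes N-B7-F1, N-B7-F2).  Family index `I` = the unit-lattice data for FIXED d, L; constants chosen before `i`.
PROOF-READING NOTE (cell census G-adv4-7, seat adv4-g8): the printed proof of (199)–(200) does not consume the
third condition of (180), |v₁ − 1| < α₃, nor the smallness α₃ ≤ c′₆ — v₁ enters only through the isometric
conjugation R(v₁^{−1}(y)) ((182)–(184)) and through the block condition «Lα′₃» ((183)); the binders
`dev v₁ < α₃` and `α₃ ≤ c₆'` are kept because they are printed (a superfluous hypothesis weakens, never falsifies,
the typed statement). [cite: Balaban1985Averaging, Prop. 9 (199)–(200) p.49] -/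
def Prop9Printed {I : Type} (L : ℝ) (fam : I → GaugeOneStep) : Prop :=
  ∀ M : ℝ, 0 < M → ∃ C₄' C₅' c₆' : ℝ, 0 < C₄' ∧ 0 < C₅' ∧ 0 < c₆' ∧
    ∀ i : I, ∀ α₀ α₃ α₃' α₄ α₄' : ℝ,
      0 < α₀ → α₀ ≤ c₆' → 0 < α₃ → α₃ ≤ c₆' → 0 < α₃' → α₃' ≤ c₆' →
      0 < α₄ → α₄ ≤ c₆' → 0 < α₄' → α₄' ≤ c₆' → α₄' ≤ M * α₄ →
      ∀ V₀ : (fam i).Cfg, ∀ v' v₁ : (fam i).GT,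
        (fam i).plaqDev V₀ < α₀ → (fam i).dev v' < α₄ → (fam i).covDev V₀ v' < α₄' →
        (fam i).dev v₁ < α₃ → (fam i).blockCovDev V₀ v₁ < L * α₃' →
          (fam i).avgCovDev V₀ v₁ v' < L * α₄' + C₄' * L ^ 2 * (α₀ * α₄ + α₃' * α₄' + α₄' ^ 2) ∧
          (fam i).avgDev V₀ v₁ v' < α₄ + C₅' * L * α₄'

/-- **Proposition 10** (p. 50 [PDF 34], verbatim): *"There exist positive constants C₄, C₅, c₆ such that
for arbitrary configurations U₀, u′, u₁ satisfying (52), (176), (177), (166), (167) with α₀, α₃, α₄ ≤ c₆ the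
bounds (203), (204) hold for j ≤ k."*  (203): |(ũ′^j)^{−1}(c₋)R̄^j_{0,c}ũ′^j(c₊) − 1| < α₄L^jη +
C₄β(L^jη)², β = α₀α₄ + α₃α₄ + α₄²; (204): |ũ′^j(y) − 1| < α₄ + 2C′₅α₄(Lη + … + L^jη), typed with the
closed bound α₄ + 2C′₅α₄L^jη/(1 − L^{−1}) ≤ α₄(1 + 4C′₅L^jη) =: "u′ ∈ Λ_k(C₅α₄)", C₅ = 1 + 4C′₅.
(Prop. 9, p. 49, the one-step version (199)–(200), is `Prop9Printed` above; the induction (203)–(206),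
Prop. 10 ⇐ Prop. 9, is kernel-checked below: `step205_alg`, `prop10_induction`, `ineq204_closed`; census C-B7-5,
C-B7-F.)  PROOF-READING NOTE (cell census G-adv4-7): the hypothesis (166) for u₁ (`InLambda`'s |u₁ − 1| < α₃ part)
and the smallness α₃ ≤ c₆ are not consumed by the printed proof of (203)–(206) either (u₁ enters through (167)
alone); in Prop. 8, by contrast, (166) IS used ((175) line 1), so Λ_k(U₀, α₃) is the right class there and a
stronger-than-needed one here; binders kept as printed. [cite: Balaban1985Averaging, Prop. 10 (203)–(204) p.50] -/
def Prop10Printed {I : Type} (fam : I → GaugeData) : Prop :=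
  ∃ C₄ C₅' c₆ : ℝ, 0 < C₄ ∧ 0 < C₅' ∧ 0 < c₆ ∧
    ∀ i : I, ∀ α₀ α₃ α₄ : ℝ, 0 < α₀ → α₀ ≤ c₆ → 0 < α₃ → α₃ ≤ c₆ → 0 < α₄ → α₄ ≤ c₆ →
      ∀ U₀ : (fam i).Cfg, ∀ u' u₁ : (fam i).GT,
        (fam i).plaqDevEta U₀ < α₀ → (fam i).Reg176 α₄ u' → (fam i).InLambda U₀ α₃ u₁ →
          ∀ j : ℕ, j ≤ (fam i).k →
            (fam i).avgDev203 U₀ u₁ u' j <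
                α₄ * ((fam i).L ^ j * (fam i).eta) +
                  C₄ * (α₀ * α₄ + α₃ * α₄ + α₄ ^ 2) * ((fam i).L ^ j * (fam i).eta) ^ 2 ∧
            (fam i).avgDev204 U₀ u₁ u' j < α₄ * (1 + 4 * C₅' * ((fam i).L ^ j * (fam i).eta))

/-- C-B7-5 bookkeeping behind the closed form of (204): for L ≥ 2, Σ_{l=1}^{j} L^{l}η ≤ 2L^jη
(geometric tail with ratio L^{−1} ≤ ½), stated as the real inequality used: x/(1 − L⁻¹) ≤ 2x for x ≥ 0. [folklore] -/
theorem tail204 (L x : ℝ) (hL : 2 ≤ L) (hx : 0 ≤ x) : x / (1 - L⁻¹) ≤ 2 * x := by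
  have hLpos : 0 < L := by linarith
  have hinv : L⁻¹ ≤ 1 / 2 := by rw [inv_le_comm₀ hLpos (by norm_num)]; simpa using hL
  have hden : (1 : ℝ) / 2 ≤ 1 - L⁻¹ := by linarith
  rw [div_le_iff₀ (by linarith)]
  nlinarith

/-- Unit b07, census C-B7-F: the algebra of the printed step (205) (p. 49 [PDF 33]).  With `t = L^jη ≤ 1`,
`β = α₀α₄ + α₃α₄ + α₄²`, `C₅ ≥ 1`, `C₄ = 8C′₄C₅`, and the level-j bounds `A = RHS(203) ≤ 2α₄t` (the α′₄-slot) and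
`B = RHS(204) ≤ C₅α₄` (the α₄-slot): Proposition 9's (199) evaluated at `(α₀, α′₃, α₄, α′₄) ↦ (2α₀t², α₃t, B, A)` is
dominated by RHS(203) at level j+1: `L·A + C′₄L²(2α₀t²B + α₃tA + A²) ≤ α₄(Lt) + C₄β(Lt)²` — the printed chain
"< α₄L^{j+1}η + C₄β(L^{j+1}η)²(L^{−1} + 4C′₄C₅/C₄) ≤ …", which needs exactly `L ≥ 2`. [cite: Balaban1985Averaging, (205) p.49] -/
theorem step205_alg (L t α₀ α₃ α₄ C₄' C₅ A B : ℝ) (hL : 2 ≤ L) (ht : 0 ≤ t)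
    (hα₀ : 0 ≤ α₀) (hα₃ : 0 ≤ α₃) (hα₄ : 0 ≤ α₄) (hC₄' : 0 ≤ C₄') (hC₅ : 1 ≤ C₅)
    (hA0 : 0 ≤ A) (hA : A ≤ 2 * α₄ * t) (hB : B ≤ C₅ * α₄) :
    L * (α₄ * t + 8 * C₄' * C₅ * (α₀ * α₄ + α₃ * α₄ + α₄ ^ 2) * t ^ 2) +
        C₄' * L ^ 2 * (2 * α₀ * t ^ 2 * B + α₃ * t * A + A ^ 2)
      ≤ α₄ * (L * t) + 8 * C₄' * C₅ * (α₀ * α₄ + α₃ * α₄ + α₄ ^ 2) * (L * t) ^ 2 := by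
  -- the bracket: 2α₀t²B + α₃tA + A² ≤ t²(2C₅α₀α₄ + 2α₃α₄ + 4α₄²) ≤ 4C₅βt²
  have hq1 : 2 * α₀ * t ^ 2 * B ≤ 2 * α₀ * t ^ 2 * (C₅ * α₄) :=
    mul_le_mul_of_nonneg_left hB (by positivity)
  have hq2 : α₃ * t * A ≤ α₃ * t * (2 * α₄ * t) := mul_le_mul_of_nonneg_left hA (by positivity)
  have hq3 : A ^ 2 ≤ (2 * α₄ * t) ^ 2 := pow_le_pow_left₀ hA0 hA 2
  have hbr : 2 * α₀ * t ^ 2 * B + α₃ * t * A + A ^ 2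
      ≤ 4 * C₅ * (α₀ * α₄ + α₃ * α₄ + α₄ ^ 2) * t ^ 2 := by
    have e1 : 2 * α₀ * t ^ 2 * (C₅ * α₄) ≤ 4 * C₅ * (α₀ * α₄) * t ^ 2 := by
      nlinarith [mul_nonneg (mul_nonneg hα₀ hα₄) (sq_nonneg t), hC₅]
    have e2 : α₃ * t * (2 * α₄ * t) ≤ 4 * C₅ * (α₃ * α₄) * t ^ 2 := by
      nlinarith [mul_nonneg (mul_nonneg hα₃ hα₄) (sq_nonneg t), hC₅]
    have e3 : (2 * α₄ * t) ^ 2 ≤ 4 * C₅ * α₄ ^ 2 * t ^ 2 := by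
      nlinarith [mul_nonneg (sq_nonneg α₄) (sq_nonneg t), hC₅]
    nlinarith [e1, e2, e3]
  have hc : C₄' * L ^ 2 * (2 * α₀ * t ^ 2 * B + α₃ * t * A + A ^ 2)
      ≤ C₄' * L ^ 2 * (4 * C₅ * (α₀ * α₄ + α₃ * α₄ + α₄ ^ 2) * t ^ 2) :=
    mul_le_mul_of_nonneg_left hbr (by positivity)
  -- L·C₄βt² + 4C′₄C₅βL²t² ≤ C₄βL²t²  since  C₄/L + C₄/2 ≤ C₄  (L ≥ 2)
  have hβ0 : 0 ≤ α₀ * α₄ + α₃ * α₄ + α₄ ^ 2 := by positivity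
  have hm : 0 ≤ C₄' * C₅ * (α₀ * α₄ + α₃ * α₄ + α₄ ^ 2) * t ^ 2 := by
    have : 0 ≤ C₅ := by linarith
    positivity
  have hkey : L * (8 * C₄' * C₅ * (α₀ * α₄ + α₃ * α₄ + α₄ ^ 2) * t ^ 2)
      + C₄' * L ^ 2 * (4 * C₅ * (α₀ * α₄ + α₃ * α₄ + α₄ ^ 2) * t ^ 2)
      ≤ 8 * C₄' * C₅ * (α₀ * α₄ + α₃ * α₄ + α₄ ^ 2) * (L * t) ^ 2 := by
    nlinarith [mul_nonneg hm (by linarith : (0:ℝ) ≤ L - 2), mul_nonneg hm (by linarith : (0:ℝ) ≤ L)]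
  nlinarith [hc, hkey]


/-- **Proposition 10 ⇐ Proposition 9: (203)–(206), kernel-checked induction** (pp. 49–50 [PDF 33–34];
census C-B7-5, C-B7-F).  `a j` stands for `sup_{c ⊂ Ω^{(j)}} |(ũ′^j)^{−1}(c₋)R̄^j_{0,c}ũ′^j(c₊) − 1|`, `b j` for
`sup_{y ∈ Ω^{(j)}} |ũ′^j(y) − 1|`; (177), (176) are `a 0 < α₄η`, `b 0 < α₄`.  `step` is Proposition 9 on the
`L^jη`-lattice with `V₀ = Ū₀^j`, `v′ = ũ′^j`, `v₁ = (R₀u₁)‾^j` ((179)), exactly as printed — "α₀ replaced by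
2α₀(L^jη)², α′₃ replaced by α₃L^jη, α₄ replaced by the right-hand side of (204) …, α′₄ replaced by the right-hand
side of (203)" — stated for arbitrary admissible parameters `P₀ ≥ 2α₀(L^jη)²`, `P₃′ ≥ α₃L^jη`, `P₄ > b j`,
`P₄′ > a j`, all `≤ c′₆`, with Proposition 9's proviso "α′₄ = O(α₄)" made explicit as `P₄′ ≤ 2P₄` (DIVERGENCE
D-b07.1; the semantics of `step` = `Prop9Printed` with `M = 2` on level-j averages is D-b07.4).  Conclusion =
(203) ∧ (204) for all `j ≤ k` with `C₅ = 1 + 4C′₅`, `C₄ = 8C′₄C₅`, under the printed smallness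
"2α₀, α₃, C₅α₄, 2α₄ ≤ c′₆" and `C₄(α₀ + α₃ + α₄) ≤ 1` (p. 49: then `α₄L^jη + C₄β(L^jη)² ≤ 2α₄L^jη ≤ 2α₄`). [cite: Balaban1985Averaging, (203)–(206) pp.49–50] -/
theorem prop10_induction (L η α₀ α₃ α₄ C₄' C₅' c₆' : ℝ) (k : ℕ) (a b : ℕ → ℝ)
    (hL : 2 ≤ L) (hη : 0 < η) (hηk : L ^ k * η ≤ 1)
    (hα₀ : 0 < α₀) (hα₃ : 0 < α₃) (hα₄ : 0 < α₄) (hC₄' : 0 < C₄') (hC₅' : 0 < C₅')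
    (hs₀ : 2 * α₀ ≤ c₆') (hs₃ : α₃ ≤ c₆') (hs₄ : (1 + 4 * C₅') * α₄ ≤ c₆') (hs₄' : 2 * α₄ ≤ c₆')
    (hC₄ : 8 * C₄' * (1 + 4 * C₅') * (α₀ + α₃ + α₄) ≤ 1)
    (h0a : a 0 < α₄ * η) (h0b : b 0 < α₄)
    (step : ∀ j < k, ∀ P₀ P₃' P₄ P₄' : ℝ,
        0 < P₀ → P₀ ≤ c₆' → 0 < P₃' → P₃' ≤ c₆' → 0 < P₄ → P₄ ≤ c₆' → 0 < P₄' → P₄' ≤ c₆' →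
        α₃ ≤ c₆' → P₄' ≤ 2 * P₄ →
        2 * α₀ * (L ^ j * η) ^ 2 ≤ P₀ → α₃ * (L ^ j * η) ≤ P₃' → b j < P₄ → a j < P₄' →
        a (j + 1) < L * P₄' + C₄' * L ^ 2 * (P₀ * P₄ + P₃' * P₄' + P₄' ^ 2) ∧
        b (j + 1) < P₄ + C₅' * L * P₄') :
    ∀ j ≤ k,
      a j < α₄ * (L ^ j * η) + 8 * C₄' * (1 + 4 * C₅') * (α₀ * α₄ + α₃ * α₄ + α₄ ^ 2) * (L ^ j * η) ^ 2 ∧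
      b j < α₄ + ∑ i ∈ Finset.range j, 2 * C₅' * α₄ * (L ^ (i + 1) * η) := by
  have hL0 : 0 < L := by linarith
  have hL1 : (1 : ℝ) ≤ L := by linarith
  have hC₅1 : (1 : ℝ) ≤ 1 + 4 * C₅' := by linarith
  have hβ0 : 0 < α₀ * α₄ + α₃ * α₄ + α₄ ^ 2 := by positivity
  have hC₄0 : 0 < 8 * C₄' * (1 + 4 * C₅') := by positivity
  -- C₄ β ≤ α₄
  have hC₄β : 8 * C₄' * (1 + 4 * C₅') * (α₀ * α₄ + α₃ * α₄ + α₄ ^ 2) ≤ α₄ := by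
    have : 8 * C₄' * (1 + 4 * C₅') * (α₀ * α₄ + α₃ * α₄ + α₄ ^ 2)
        = (8 * C₄' * (1 + 4 * C₅') * (α₀ + α₃ + α₄)) * α₄ := by ring
    rw [this]; nlinarith
  intro j hj
  induction j with
  | zero =>
      refine ⟨?_, by simpa using h0b⟩
      simp only [pow_zero, one_mul]
      nlinarith [mul_pos hC₄0 hβ0, sq_nonneg η]
  | succ j ih =>
      have hjk : j < k := Nat.lt_of_succ_le hj
      obtain ⟨iha, ihb⟩ := ih (Nat.le_of_lt hjk)
      have ht0 : 0 < L ^ j * η := by positivity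
      have ht1 : L ^ j * η ≤ 1 := level_le_one L η k hL1 hη.le hηk j (Nat.le_of_lt hjk)
      have htsucc : L ^ (j + 1) * η = L * (L ^ j * η) := by ring
      generalize ht : L ^ j * η = t at *
      -- A = RHS(203)_j, B = RHS(204)_j
      have hA0 : 0 < α₄ * t + 8 * C₄' * (1 + 4 * C₅') * (α₀ * α₄ + α₃ * α₄ + α₄ ^ 2) * t ^ 2 := by
        positivity
      have hAle : α₄ * t + 8 * C₄' * (1 + 4 * C₅') * (α₀ * α₄ + α₃ * α₄ + α₄ ^ 2) * t ^ 2 ≤ 2 * α₄ * t := by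
        have : 8 * C₄' * (1 + 4 * C₅') * (α₀ * α₄ + α₃ * α₄ + α₄ ^ 2) * t ^ 2 ≤ α₄ * t := by
          have h1 := mul_le_mul hC₄β ht1 ht0.le hα₄.le
          nlinarith [h1, mul_nonneg (mul_nonneg hC₄0.le hβ0.le) ht0.le]
        linarith
      have hsum : ∑ i ∈ Finset.range j, 2 * C₅' * α₄ * (L ^ (i + 1) * η) ≤ 4 * C₅' * α₄ * t := by
        have hs := sum_pow_succ_le L η hL hη.le j
        rw [ht] at hs
        have : ∑ i ∈ Finset.range j, 2 * C₅' * α₄ * (L ^ (i + 1) * η)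
            = 2 * C₅' * α₄ * ∑ i ∈ Finset.range j, L ^ (i + 1) * η := by rw [Finset.mul_sum]
        rw [this]; nlinarith [mul_le_mul_of_nonneg_left hs (by positivity : 0 ≤ 2 * C₅' * α₄)]
      have hsum0 : 0 ≤ ∑ i ∈ Finset.range j, 2 * C₅' * α₄ * (L ^ (i + 1) * η) :=
        Finset.sum_nonneg (fun i _ => by positivity)
      have hB0 : 0 < α₄ + ∑ i ∈ Finset.range j, 2 * C₅' * α₄ * (L ^ (i + 1) * η) := by linarith
      have hBle : α₄ + ∑ i ∈ Finset.range j, 2 * C₅' * α₄ * (L ^ (i + 1) * η) ≤ (1 + 4 * C₅') * α₄ := by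
        have h := mul_le_mul_of_nonneg_left ht1 (by positivity : (0:ℝ) ≤ 4 * C₅' * α₄)
        have h' : (1 + 4 * C₅') * α₄ = α₄ + 4 * C₅' * α₄ * 1 := by ring
        rw [h']; linarith only [hsum, h]
      -- apply Prop. 9 at level j with P₀ = 2α₀t², P₃' = α₃t, P₄ = B, P₄' = A
      have ht2 : t ^ 2 ≤ 1 := by nlinarith only [ht0, ht1]
      have hP0le : 2 * α₀ * t ^ 2 ≤ c₆' := by
        have h := mul_le_mul_of_nonneg_left ht2 (by positivity : (0:ℝ) ≤ 2 * α₀)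
        linarith only [h, hs₀]
      have hP3le : α₃ * t ≤ c₆' := by
        have h := mul_le_mul_of_nonneg_left ht1 hα₃.le
        linarith only [h, hs₃]
      have hA2 : α₄ * t + 8 * C₄' * (1 + 4 * C₅') * (α₀ * α₄ + α₃ * α₄ + α₄ ^ 2) * t ^ 2 ≤ 2 * α₄ := by
        have h := mul_le_mul_of_nonneg_left ht1 (by positivity : (0:ℝ) ≤ 2 * α₄)
        linarith only [hAle, h]
      have hAc : α₄ * t + 8 * C₄' * (1 + 4 * C₅') * (α₀ * α₄ + α₃ * α₄ + α₄ ^ 2) * t ^ 2 ≤ c₆' := by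
        linarith only [hA2, hs₄']
      have hAB : α₄ * t + 8 * C₄' * (1 + 4 * C₅') * (α₀ * α₄ + α₃ * α₄ + α₄ ^ 2) * t ^ 2
          ≤ 2 * (α₄ + ∑ i ∈ Finset.range j, 2 * C₅' * α₄ * (L ^ (i + 1) * η)) := by
        linarith only [hA2, hsum0]
      have hBc : α₄ + ∑ i ∈ Finset.range j, 2 * C₅' * α₄ * (L ^ (i + 1) * η) ≤ c₆' := by
        linarith only [hBle, hs₄]
      have hst := step j hjk (2 * α₀ * t ^ 2) (α₃ * t) _ _
        (by positivity) hP0le (by positivity) hP3le hB0 hBc hA0 hAc hs₃ hAB (by rw [ht]) (by rw [ht]) ihb iha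
      obtain ⟨ha', hb'⟩ := hst
      refine ⟨?_, ?_⟩
      · rw [htsucc]
        exact lt_of_lt_of_le ha' (step205_alg L t α₀ α₃ α₄ C₄' (1 + 4 * C₅') _ _ hL ht0.le hα₀.le hα₃.le
          hα₄.le hC₄'.le hC₅1 hA0.le hAle hBle)
      · rw [Finset.sum_range_succ, htsucc]
        have h := mul_le_mul_of_nonneg_left hAle (by positivity : (0:ℝ) ≤ C₅' * L)
        have h' : C₅' * L * (2 * α₄ * t) = 2 * C₅' * α₄ * (L * t) := by ring
        rw [h'] at h
        linarith only [hb', h]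


/-- The closed form of (204) used in `Prop10Printed` (C-B7-5; cf. `tail204`): for `L ≥ 2`,
`α₄ + 2C′₅α₄Lη + … + 2C′₅α₄L^jη ≤ α₄(1 + 4C′₅L^jη)` (DIVERGENCE D-b07.2). [cite: Balaban1985Averaging, (204) p.49] -/
theorem ineq204_closed (L η α₄ C₅' : ℝ) (hL : 2 ≤ L) (hη : 0 ≤ η) (hα₄ : 0 ≤ α₄) (hC₅' : 0 ≤ C₅') (j : ℕ) :
    α₄ + ∑ i ∈ Finset.range j, 2 * C₅' * α₄ * (L ^ (i + 1) * η) ≤ α₄ * (1 + 4 * C₅' * (L ^ j * η)) := by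
  have hs := sum_pow_succ_le L η hL hη j
  have : ∑ i ∈ Finset.range j, 2 * C₅' * α₄ * (L ^ (i + 1) * η)
      = 2 * C₅' * α₄ * ∑ i ∈ Finset.range j, L ^ (i + 1) * η := by rw [Finset.mul_sum]
  rw [this]
  nlinarith [mul_le_mul_of_nonneg_left hs (by positivity : 0 ≤ 2 * C₅' * α₄)]

/-- The conclusion atom consumed downstream (Dag.lean `B7_concl` refines to this record): the printed
propositions of B7 for fixed (d, L), each over its own family (Prop. 9 added by unit b07). [cite: Balaban1985Averaging, Props. 1–10 pp.26–50] -/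
structure Concl {I₁ I₂ I₃ I₄ I₅ : Type} (L c₂ C₀ c₂' : ℝ) (one : I₁ → OneStep) (kst : I₂ → KStep)
    (kexp : I₃ → KExp) (gd : I₄ → GaugeData) (gone : I₅ → GaugeOneStep) : Prop where
  p1 : Prop1Printed L one
  p2 : Prop2Printed C₀ c₂' kst
  p3 : Prop3Printed L c₂ one
  p4 : Prop4Printed kexp
  p5 : Prop5Printed kexp
  p6 : Prop6Printed kexp
  p7 : Prop7Printed kexp
  p8 : Prop8Printed gd
  p9 : Prop9Printed L gone
  p10 : Prop10Printed gd

end Literature.MathematicalPhysics.QuantumFieldTheory.Balaban1983to89.B7
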